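import Mathlib
import HarnessLib
import Summits.HubbardSuperconductivity.HubbardSuperconductivity.Theorems.KLProgrammeLatticePeriodicExtension

/-!
# Route `KLProgramme` — ENGINE stmt-HubbardSuperconductivity-20437 `KLRegimeEngineV17F2`, row (c) value lane: periodic Lipschitz extension of lattice data GIVEN ON A SUBSET
# (McShane on a finite set of torus momenta, clamped) — brick 3a of cure (A″) of located «(c)-OUT-COOPER-ANTIPODE» (pen (R437)); cell gate-hubbard-kl, seat hubbard-kl-k3c2-p2 g25

WHY.  `…LatticePeriodicExtension` (g17) extends a lattice function `g : TorusSite 2 L → ℂ` with a GLOBAL torus-Lipschitz constant `K` to the plane (clamped McShane over ALL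
lattice points).  The angular-CELL re-thread of the (c)-OUT forward rows (CELL-SIGNATURES.md / COOPER-ANTIPODE.md §6, evidence on 20437) needs the extension of `g`
RESTRICTED TO A CELL `S` (a finite set of torus momenta — a ball around a Fermi point) with the cell's OWN Lipschitz constant `K_S` and sup `B_S`: the extension must agree with
`g` on `S`, be `2K_S`-Lipschitz and bounded by `2B_S` EVERYWHERE, periodic and continuous — so that, glued by an angular partition of unity, the planar weight has RAY-LOCAL data
(the input of `klfb_ray_bubble_norm_le_tube`, …ForwardBubbleRayTube).  McShane's formula does exactly this when the infimum runs over `S` only: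
* §1 `klpeInfOn S hS g K p = ⊓_{k̃ ∈ S} (g k̃ + K·|p − P k̃|_𝕋)`, `klpeExtROn` (clamped to `[−B, B]`): `klpe_infOn_apply_mem` (agrees with `g` on `S` when `g` is `K`-Lipschitz ON `S`),
  `klpe_infOn_lipschitz`, `klpe_extROn_apply_mem`, `klpe_abs_extROn_le`, `klpe_extROn_lipschitz`, `klpe_extROn_periodic`, `klpe_continuous_extROn`;
* §2 complex `klpeExtOn`: **`klpe_extOn_apply_mem`** / `_latticeMomentum`, **`klpe_norm_extOn_le`** (`2B`), **`klpe_extOn_lipschitz`** (`2K`), `klpe_extOn_periodic₁/₂`,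
  `klpe_continuous_extOn`, packaged **`klpe_exists_periodic_lipschitz_extensionOn`**.
Pure analysis (the g17 proofs with `Finset.univ ↦ S`); nothing about the model is asserted.  0 kit · 0 lit.
-/

noncomputable section

namespace Summit.HubbardSuperconductivity.HubbardSuperconductivity.Theorems.KLRegimeSplit

set_option linter.dupNamespace false -- summit = problem name (single-conjunct summit), D-0017

open Real Set Finset Literature.MathematicalPhysics.QuantumLattice
open Literature.Probability.LatticeModels hiding torusSupNorm
open Summit.HubbardSuperconductivity.HubbardSuperconductivity.Theorems.KLProgrammeLegKernels
open Summit.HubbardSuperconductivity.HubbardSuperconductivity.Theorems.EngineV8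

/-! ## §1 The real extension from a subset -/

section Real

variable {L : ℕ}

/-- McShane's formula over a nonempty finite set `S` of lattice momenta: `⊓_{k̃ ∈ S} (g k̃ + K·|p − P k̃|_𝕋)`. -/
def klpeInfOn (S : Finset (TorusSite 2 L)) (hS : S.Nonempty) (g : TorusSite 2 L → ℝ) (K : ℝ) (p : ℝ × ℝ) : ℝ :=
  S.inf' hS fun k => g k + K * torusSupNorm (p - klpeP L k)

/-- The clamped real extension from `S`: `max (−B) (min B (klpeInfOn S hS g K p))`. -/
def klpeExtROn (S : Finset (TorusSite 2 L)) (hS : S.Nonempty) (g : TorusSite 2 L → ℝ) (B K : ℝ) (p : ℝ × ℝ) : ℝ :=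
  max (-B) (min B (klpeInfOn S hS g K p))

/-- The infimum agrees with `g` ON `S` when `g` is `K`-Lipschitz for the torus norm ON `S`. -/
theorem klpe_infOn_apply_mem [NeZero L] {S : Finset (TorusSite 2 L)} (hS : S.Nonempty) {g : TorusSite 2 L → ℝ} {K : ℝ}
    (hg : ∀ k ∈ S, ∀ k' ∈ S, |g k - g k'| ≤ K * klTorusNorm L (k - k')) {k₀ : TorusSite 2 L} (hk₀ : k₀ ∈ S) :
    klpeInfOn S hS g K (klpeP L k₀) = g k₀ := by
  unfold klpeInfOn
  refine le_antisymm ?_ ?_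
  · refine (Finset.inf'_le _ hk₀).trans ?_
    rw [sub_self]
    unfold torusSupNorm
    simp [klvc_torusAbs_zero]
  · refine Finset.le_inf' _ _ fun k hk => ?_
    rw [klpe_tau_P_sub_P]
    have h := hg k₀ hk₀ k hk
    rw [abs_le] at h
    linarith [h.1]

/-- The infimum over `S` is `K`-Lipschitz for the torus norm (`0 ≤ K`). -/
theorem klpe_infOn_lipschitz {S : Finset (TorusSite 2 L)} (hS : S.Nonempty) (g : TorusSite 2 L → ℝ) {K : ℝ} (hK : 0 ≤ K)
    (p q : ℝ × ℝ) : |klpeInfOn S hS g K p - klpeInfOn S hS g K q| ≤ K * torusSupNorm (p - q) := by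
  unfold klpeInfOn
  have key : ∀ (p q : ℝ × ℝ),
      S.inf' hS (fun k => g k + K * torusSupNorm (p - klpeP L k)) ≤
        S.inf' hS (fun k => g k + K * torusSupNorm (q - klpeP L k)) + K * torusSupNorm (p - q) := by
    intro p q
    obtain ⟨k, hkS, hk⟩ := Finset.exists_mem_eq_inf' hS (fun k => g k + K * torusSupNorm (q - klpeP L k))
    rw [hk]
    refine (Finset.inf'_le _ hkS).trans ?_
    have h := klpe_abs_tau_sub_tau_le p q (klpeP L k)
    rw [abs_le] at h
    nlinarith [h.2]
  rw [abs_le]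
  constructor
  · have h := key q p
    rw [← neg_sub p q, klpe_tau_neg] at h
    linarith
  · linarith [key p q]

/-- **The clamped extension agrees with `g` on `S`** (`|g| ≤ B` on `S`, `g` `K`-Lipschitz on `S`). -/
theorem klpe_extROn_apply_mem [NeZero L] {S : Finset (TorusSite 2 L)} (hS : S.Nonempty) {g : TorusSite 2 L → ℝ} {B K : ℝ}
    (hgB : ∀ k ∈ S, |g k| ≤ B) (hg : ∀ k ∈ S, ∀ k' ∈ S, |g k - g k'| ≤ K * klTorusNorm L (k - k')) {k₀ : TorusSite 2 L} (hk₀ : k₀ ∈ S) :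
    klpeExtROn S hS g B K (klpeP L k₀) = g k₀ := by
  unfold klpeExtROn
  rw [klpe_infOn_apply_mem hS hg hk₀]
  have h := hgB k₀ hk₀
  rw [abs_le] at h
  rw [min_eq_right h.2, max_eq_right h.1]

/-- `|klpeExtROn S hS g B K p| ≤ B` (`0 ≤ B`). -/
theorem klpe_abs_extROn_le {S : Finset (TorusSite 2 L)} (hS : S.Nonempty) (g : TorusSite 2 L → ℝ) {B : ℝ} (hB : 0 ≤ B) (K : ℝ)
    (p : ℝ × ℝ) : |klpeExtROn S hS g B K p| ≤ B := by
  unfold klpeExtROn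
  rw [abs_le]
  exact ⟨le_max_left _ _, max_le (by linarith) (min_le_left _ _)⟩

/-- **The clamped extension is `K`-Lipschitz in the sup metric** (`0 ≤ K`). -/
theorem klpe_extROn_lipschitz {S : Finset (TorusSite 2 L)} (hS : S.Nonempty) (g : TorusSite 2 L → ℝ) (B : ℝ) {K : ℝ} (hK : 0 ≤ K)
    (p q : ℝ × ℝ) : |klpeExtROn S hS g B K p - klpeExtROn S hS g B K q| ≤ K * dist p q := by
  unfold klpeExtROn
  have h1 := abs_max_sub_max_le_max (-B) (min B (klpeInfOn S hS g K p)) (-B) (min B (klpeInfOn S hS g K q))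
  have h2 := abs_min_sub_min_le_max B (klpeInfOn S hS g K p) B (klpeInfOn S hS g K q)
  simp only [sub_self, abs_zero] at h1 h2
  have h3 := (klpe_infOn_lipschitz hS g hK p q).trans (mul_le_mul_of_nonneg_left (klpe_tau_sub_le_dist p q) hK)
  have h0 : 0 ≤ K * dist p q := mul_nonneg hK dist_nonneg
  calc |max (-B) (min B (klpeInfOn S hS g K p)) - max (-B) (min B (klpeInfOn S hS g K q))|
      ≤ max 0 |min B (klpeInfOn S hS g K p) - min B (klpeInfOn S hS g K q)| := h1
    _ ≤ max 0 (max 0 |klpeInfOn S hS g K p - klpeInfOn S hS g K q|) := max_le_max le_rfl h2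
    _ ≤ K * dist p q := max_le h0 (max_le h0 h3)

/-- Periodicity of the clamped extension from `S`. -/
theorem klpe_extROn_periodic {S : Finset (TorusSite 2 L)} (hS : S.Nonempty) (g : TorusSite 2 L → ℝ) (B K : ℝ) (x y : ℝ) :
    klpeExtROn S hS g B K (x + 2 * π, y) = klpeExtROn S hS g B K (x, y) ∧
      klpeExtROn S hS g B K (x, y + 2 * π) = klpeExtROn S hS g B K (x, y) := by
  have e1 : klpeInfOn S hS g K (x + 2 * π, y) = klpeInfOn S hS g K (x, y) := by
    unfold klpeInfOn
    congr 1; funext k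
    have h := (klpe_tau_add_two_pi ((x, y) - klpeP L k)).1
    rw [show ((x + 2 * π, y) : ℝ × ℝ) - klpeP L k = ((x, y) - klpeP L k) + (2 * π, 0) by ext <;> simp [add_sub_right_comm], h]
  have e2 : klpeInfOn S hS g K (x, y + 2 * π) = klpeInfOn S hS g K (x, y) := by
    unfold klpeInfOn
    congr 1; funext k
    have h := (klpe_tau_add_two_pi ((x, y) - klpeP L k)).2
    rw [show ((x, y + 2 * π) : ℝ × ℝ) - klpeP L k = ((x, y) - klpeP L k) + (0, 2 * π) by ext <;> simp [add_sub_right_comm], h]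
  unfold klpeExtROn
  rw [e1, e2]
  exact ⟨rfl, rfl⟩

/-- Continuity of the clamped extension from `S` (`0 ≤ K`). -/
theorem klpe_continuous_extROn {S : Finset (TorusSite 2 L)} (hS : S.Nonempty) (g : TorusSite 2 L → ℝ) (B : ℝ) {K : ℝ} (hK : 0 ≤ K) :
    Continuous (klpeExtROn S hS g B K) :=
  (LipschitzWith.of_dist_le_mul (K := ⟨K, hK⟩) fun p q => by
    rw [Real.dist_eq]; exact klpe_extROn_lipschitz hS g B hK p q).continuous

end Real

/-! ## §2 The complex extension from a subset -/

section Complex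

variable {L : ℕ}

/-- **The complex periodic Lipschitz extension from `S`**: real and imaginary parts extended separately. -/
def klpeExtOn (S : Finset (TorusSite 2 L)) (hS : S.Nonempty) (g : TorusSite 2 L → ℂ) (B K : ℝ) (p : ℝ × ℝ) : ℂ :=
  ((klpeExtROn S hS (fun k => (g k).re) B K p : ℝ) : ℂ) + ((klpeExtROn S hS (fun k => (g k).im) B K p : ℝ) : ℂ) * Complex.I

/-- Real/imaginary parts inherit the sup bound and the Lipschitz constant ON `S`. -/
theorem klpe_re_dataOn {S : Finset (TorusSite 2 L)} {g : TorusSite 2 L → ℂ} {B K : ℝ} (hgB : ∀ k ∈ S, ‖g k‖ ≤ B)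
    (hg : ∀ k ∈ S, ∀ k' ∈ S, ‖g k - g k'‖ ≤ K * klTorusNorm L (k - k')) :
    (∀ k ∈ S, |(g k).re| ≤ B) ∧ (∀ k ∈ S, ∀ k' ∈ S, |(g k).re - (g k').re| ≤ K * klTorusNorm L (k - k')) ∧
    (∀ k ∈ S, |(g k).im| ≤ B) ∧ (∀ k ∈ S, ∀ k' ∈ S, |(g k).im - (g k').im| ≤ K * klTorusNorm L (k - k')) :=
  ⟨fun k hk => (Complex.abs_re_le_norm _).trans (hgB k hk), fun k hk k' hk' => by
      rw [← Complex.sub_re]; exact (Complex.abs_re_le_norm _).trans (hg k hk k' hk'),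
    fun k hk => (Complex.abs_im_le_norm _).trans (hgB k hk), fun k hk k' hk' => by
      rw [← Complex.sub_im]; exact (Complex.abs_im_le_norm _).trans (hg k hk k' hk')⟩

/-- **Agreement on `S`**: `klpeExtOn S hS g B K (P k̃) = g k̃` for `k̃ ∈ S` (`‖g‖ ≤ B` on `S`, `g` `K`-Lipschitz on `S`). -/
theorem klpe_extOn_apply_mem [NeZero L] {S : Finset (TorusSite 2 L)} (hS : S.Nonempty) {g : TorusSite 2 L → ℂ} {B K : ℝ} (hgB : ∀ k ∈ S, ‖g k‖ ≤ B)
    (hg : ∀ k ∈ S, ∀ k' ∈ S, ‖g k - g k'‖ ≤ K * klTorusNorm L (k - k')) {k₀ : TorusSite 2 L} (hk₀ : k₀ ∈ S) :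
    klpeExtOn S hS g B K (klpeP L k₀) = g k₀ := by
  obtain ⟨h1, h2, h3, h4⟩ := klpe_re_dataOn hgB hg
  unfold klpeExtOn
  rw [klpe_extROn_apply_mem hS h1 h2 hk₀, klpe_extROn_apply_mem hS h3 h4 hk₀]
  exact Complex.re_add_im (g k₀)

/-- The same at the coordinates `(p_k̃ 0, p_k̃ 1)`. -/
theorem klpe_extOn_apply_latticeMomentum [NeZero L] {S : Finset (TorusSite 2 L)} (hS : S.Nonempty) {g : TorusSite 2 L → ℂ} {B K : ℝ}
    (hgB : ∀ k ∈ S, ‖g k‖ ≤ B) (hg : ∀ k ∈ S, ∀ k' ∈ S, ‖g k - g k'‖ ≤ K * klTorusNorm L (k - k')) {k₀ : TorusSite 2 L} (hk₀ : k₀ ∈ S) :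
    klpeExtOn S hS g B K (latticeMomentum L k₀ 0, latticeMomentum L k₀ 1) = g k₀ :=
  klpe_extOn_apply_mem hS hgB hg hk₀

/-- **Sup bound**: `‖klpeExtOn S hS g B K p‖ ≤ 2B` (`0 ≤ B`). -/
theorem klpe_norm_extOn_le {S : Finset (TorusSite 2 L)} (hS : S.Nonempty) (g : TorusSite 2 L → ℂ) {B : ℝ} (hB : 0 ≤ B) (K : ℝ)
    (p : ℝ × ℝ) : ‖klpeExtOn S hS g B K p‖ ≤ 2 * B := by
  unfold klpeExtOn
  refine (norm_add_le _ _).trans ?_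
  rw [norm_mul, Complex.norm_I, mul_one, Complex.norm_real, Complex.norm_real, Real.norm_eq_abs, Real.norm_eq_abs]
  linarith [klpe_abs_extROn_le hS (fun k => (g k).re) hB K p, klpe_abs_extROn_le hS (fun k => (g k).im) hB K p]

/-- **Lipschitz**: `‖klpeExtOn S hS g B K p − klpeExtOn S hS g B K q‖ ≤ 2K·dist p q` (`0 ≤ K`). -/
theorem klpe_extOn_lipschitz {S : Finset (TorusSite 2 L)} (hS : S.Nonempty) (g : TorusSite 2 L → ℂ) (B : ℝ) {K : ℝ} (hK : 0 ≤ K)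
    (p q : ℝ × ℝ) : ‖klpeExtOn S hS g B K p - klpeExtOn S hS g B K q‖ ≤ 2 * K * dist p q := by
  unfold klpeExtOn
  have e : (((klpeExtROn S hS (fun k => (g k).re) B K p : ℝ) : ℂ) + ((klpeExtROn S hS (fun k => (g k).im) B K p : ℝ) : ℂ) * Complex.I) -
      (((klpeExtROn S hS (fun k => (g k).re) B K q : ℝ) : ℂ) + ((klpeExtROn S hS (fun k => (g k).im) B K q : ℝ) : ℂ) * Complex.I) =
      (((klpeExtROn S hS (fun k => (g k).re) B K p - klpeExtROn S hS (fun k => (g k).re) B K q : ℝ)) : ℂ) +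
        (((klpeExtROn S hS (fun k => (g k).im) B K p - klpeExtROn S hS (fun k => (g k).im) B K q : ℝ)) : ℂ) * Complex.I := by
    push_cast; ring
  rw [e]
  refine (norm_add_le _ _).trans ?_
  rw [norm_mul, Complex.norm_I, mul_one, Complex.norm_real, Complex.norm_real, Real.norm_eq_abs, Real.norm_eq_abs]
  linarith [klpe_extROn_lipschitz hS (fun k => (g k).re) B hK p q, klpe_extROn_lipschitz hS (fun k => (g k).im) B hK p q]

/-- **Periodicity** (first coordinate). -/
theorem klpe_extOn_periodic₁ {S : Finset (TorusSite 2 L)} (hS : S.Nonempty) (g : TorusSite 2 L → ℂ) (B K : ℝ) (x y : ℝ) :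
    klpeExtOn S hS g B K (x + 2 * π, y) = klpeExtOn S hS g B K (x, y) := by
  unfold klpeExtOn
  rw [(klpe_extROn_periodic hS _ B K x y).1, (klpe_extROn_periodic hS _ B K x y).1]

/-- **Periodicity** (second coordinate). -/
theorem klpe_extOn_periodic₂ {S : Finset (TorusSite 2 L)} (hS : S.Nonempty) (g : TorusSite 2 L → ℂ) (B K : ℝ) (x y : ℝ) :
    klpeExtOn S hS g B K (x, y + 2 * π) = klpeExtOn S hS g B K (x, y) := by
  unfold klpeExtOn
  rw [(klpe_extROn_periodic hS _ B K x y).2, (klpe_extROn_periodic hS _ B K x y).2]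

/-- **Continuity** (`0 ≤ K`). -/
theorem klpe_continuous_extOn {S : Finset (TorusSite 2 L)} (hS : S.Nonempty) (g : TorusSite 2 L → ℂ) (B : ℝ) {K : ℝ} (hK : 0 ≤ K) :
    Continuous (klpeExtOn S hS g B K) := by
  unfold klpeExtOn
  exact (Complex.continuous_ofReal.comp (klpe_continuous_extROn hS _ B hK)).add
    ((Complex.continuous_ofReal.comp (klpe_continuous_extROn hS _ B hK)).mul continuous_const)

/-- **PERIODIC LIPSCHITZ EXTENSION OF LATTICE DATA GIVEN ON A CELL** (packaged): if on a nonempty finite set `S` of torus momenta `‖g‖ ≤ B` and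
`‖g k̃ − g k̃′‖ ≤ K·klTorusNorm L (k̃ − k̃′)` (`0 ≤ B`, `0 ≤ K`), there is a continuous doubly `2π`-periodic `G : ℝ × ℝ → ℂ` with `‖G‖ ≤ 2B`, Lipschitz `2K` (sup metric)
EVERYWHERE, and `G (p_k̃ 0, p_k̃ 1) = g k̃` for `k̃ ∈ S`. -/
theorem klpe_exists_periodic_lipschitz_extensionOn [NeZero L] {S : Finset (TorusSite 2 L)} (hS : S.Nonempty) (g : TorusSite 2 L → ℂ) {B K : ℝ}
    (hB : 0 ≤ B) (hK : 0 ≤ K) (hgB : ∀ k ∈ S, ‖g k‖ ≤ B) (hg : ∀ k ∈ S, ∀ k' ∈ S, ‖g k - g k'‖ ≤ K * klTorusNorm L (k - k')) :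
    ∃ G : ℝ × ℝ → ℂ, Continuous G ∧ (∀ x y, G (x + 2 * π, y) = G (x, y)) ∧ (∀ x y, G (x, y + 2 * π) = G (x, y)) ∧
      (∀ p, ‖G p‖ ≤ 2 * B) ∧ (∀ p q, ‖G p - G q‖ ≤ 2 * K * dist p q) ∧
      ∀ k ∈ S, G (latticeMomentum L k 0, latticeMomentum L k 1) = g k :=
  ⟨klpeExtOn S hS g B K, klpe_continuous_extOn hS g B hK, klpe_extOn_periodic₁ hS g B K, klpe_extOn_periodic₂ hS g B K,
    klpe_norm_extOn_le hS g hB K, klpe_extOn_lipschitz hS g B hK, fun _ hk => klpe_extOn_apply_latticeMomentum hS hgB hg hk⟩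

end Complex

end Summit.HubbardSuperconductivity.HubbardSuperconductivity.Theorems.KLRegimeSplit

end
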